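import Mathlib
import Literature.Analysis.FluidPDE.VectorCalculus
import Summits.NavierStokesRegularity.NavierStokesRegularity.Theorems.FilamentSkeletonRssClause13RAdjointPunctured

/-!
# Clause 13-R, STUB R at MODEL level: the ENERGY INEQUALITY and the `L²` SIZE BOUND for the SOURCED model adjoint equation in the
# PUNCTURED class (crux `Clause13RNearStraightL`, stmt-NavierStokesRegularity-23612; line `rate_bordered_split`, STUB R `stub_rateRow13RFlat`)

Route `FilamentSkeletonRss`, Variant A1R.  `…Clause13RAdjointEnergy.model_adjoint_apriori` (p828845) is the stability half of the repaired
census item (c′) («existence and SIZE of the edge-sourced density») for `C¹` densities: `ε ∫_S ‖φ‖² ≤ ∫_S ⟪h, φ⟫`.  The density part of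
an annihilating measure is, however, only the bounded waist-regular branch on each PUNCTURED half-ball (`…Clause13RAdjointWaistSourced`
p831138), differentiable on `S ∖ {c}` with nothing known at the waist station `c`.  THIS FILE proves the energy inequality in that class,
by the `η`-free improper identity of `…Clause13RAdjointPunctured` (p832184: FTC for the flux `w‖φ‖²` on `[a, c]` and `[c, b]` separately,
`P(c) = 0` automatically; nonlocal pairing `= 0` by p832081):
* `model_adjoint_apriori_punctured` — `ε ∫_a^b ‖φ‖² + ½(w(b)‖φ(b)‖² − w(a)‖φ(a)‖²) ≤ ∫_a^b ⟪h, φ⟫` for every solution of the sourced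
  equation on `S ∖ {c}` that is differentiable on `S ∖ {c}` and bounded on `S`, with ANY source `h ∈ L¹(S)` (`a < c < b`, `w(c) = 0`,
  `w′ ≥ −1 + 2ε`);
* `model_adjoint_l2_le_punctured` — hence `ε ∫_a^b ‖φ‖² ≤ ∫_a^b ⟪h, φ⟫` when `w(a) ≤ 0 ≤ w(b)`: the `L²` size of the density is
  controlled by its source, i.e. (for the edge-sourced equation) by the atoms `e₊, e₋`.
Together with uniqueness in the punctured class (`…Clause13RAdjointPuncturedUnique`) this leaves, at model level, exactly the EXISTENCE of
the edge-sourced density as the open part of (c′).  [folklore] (energy method).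
Hand `leafhand-ns-filamentskeletonrs-19-g1` (LAND-ONLY); `--supports stmt-NavierStokesRegularity-23612` helper, def-free.  HONEST FRAMING:
bookkeeping for the MODEL adjoint equation attached to a HYPOTHETICAL filament skeleton on the NEGATIVE side of a MODEL blow-up route;
STUB R is NOT proved here and nothing in this file bears on Navier–Stokes regularity or blow-up.
-/

noncomputable section

open MeasureTheory Filter Topology Set intervalIntegral
open scoped RealInnerProductSpace InnerProductSpace
open Literature.Analysis.FluidPDE
open Summit.NavierStokesRegularity.NavierStokesRegularity.Theorems.Clause13RAdjointEnergy (inner_cross_left_swap)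
open Summit.NavierStokesRegularity.NavierStokesRegularity.Theorems.Clause13RAdjointNonlocalBounded
open Summit.NavierStokesRegularity.NavierStokesRegularity.Theorems.Clause13RAdjointPunctured

namespace Summit.NavierStokesRegularity.NavierStokesRegularity.Theorems.Clause13RAdjointPuncturedApriori
set_option linter.dupNamespace false

/-- **Pairing the SOURCED equation with `φ`** (pointwise, off the waist): the flux derivative equals
`2⟪h, φ⟫ + 2cst⟪N, φ⟫ − (1 + w′)‖φ‖²`. [folklore] -/
theorem flux_deriv_eq_sourced {cst α : ℝ} {m w w' : ℝ → ℝ} {φ φ' : ℝ → EuclideanSpace ℝ (Fin 3)} {d e : EuclideanSpace ℝ (Fin 3)}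
    {N : ℝ → EuclideanSpace ℝ (Fin 3)} {hs : EuclideanSpace ℝ (Fin 3)} {σ : ℝ}
    (heq : cst • (m σ • cross (φ σ) d - N σ) + (1 / 2 : ℝ) • φ σ + α • cross e (φ σ) + w' σ • φ σ + w σ • φ' σ = hs) :
    w' σ * ‖φ σ‖ ^ 2 + 2 * w σ * ⟪φ' σ, φ σ⟫ = 2 * ⟪hs, φ σ⟫ + 2 * cst * ⟪N σ, φ σ⟫ - (1 + w' σ) * ‖φ σ‖ ^ 2 := by
  have hx0 : ⟪cross (φ σ) d, φ σ⟫ = 0 := by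
    have h := inner_cross_left_swap (φ σ) (φ σ) d
    linarith
  have he0 : ⟪cross e (φ σ), φ σ⟫ = 0 := by
    simp only [cross, cross_apply, PiLp.inner_apply, RCLike.inner_apply, conj_trivial, Fin.sum_univ_three,
      Matrix.cons_val_zero, Matrix.cons_val_one, Matrix.cons_val_two, Matrix.head_cons, Matrix.tail_cons]
    ring
  have h := congrArg (fun v => ⟪v, φ σ⟫) heq
  simp only [inner_add_left, inner_sub_left, inner_smul_left, conj_trivial, hx0, he0,
    real_inner_self_eq_norm_sq, mul_zero] at h
  linarith

/-- **ENERGY INEQUALITY for the SOURCED model adjoint equation, punctured class.**  On `S = [a, b]` with `a < c < b`, slip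
`w ∈ C¹(ℝ)` with `w(c) = 0` and `w′ ≥ −1 + 2ε` on `S` (any real `ε`), continuous even kernel `k`, any scalar weight `m`, constants `cst, α`,
vectors `d, e`, and a source `h` integrable on `S`: every `φ` differentiable on `S ∖ {c}`, bounded on `S`, solving
`cst • (m σ • (φ σ × d) − ∫_{τ∈S} k(τ−σ) • (φ τ × d) dτ) + ½ φ σ + α e × φ σ + w′ σ φ σ + w σ φ′ σ = h σ` on `S ∖ {c}` satisfies
`ε ∫_a^b ‖φ‖² + ½(w(b)‖φ(b)‖² − w(a)‖φ(a)‖²) ≤ ∫_a^b ⟪h, φ⟫`.  (The hypotheses `w(a) ≤ 0 ≤ w(b)` are not needed for this form.) [folklore] -/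
theorem model_adjoint_apriori_punctured {a b c cst α ε M : ℝ} (hac : a < c) (hcb : c < b)
    {k m w w' : ℝ → ℝ} {φ φ' h : ℝ → EuclideanSpace ℝ (Fin 3)} {d e : EuclideanSpace ℝ (Fin 3)}
    (hk : Continuous k) (hkev : ∀ s, k (-s) = k s)
    (hw : ∀ σ, HasDerivAt w (w' σ) σ) (hw'c : Continuous w') (hwc0 : w c = 0)
    (hgrowth : ∀ σ ∈ Icc a b, -1 + 2 * ε ≤ w' σ)
    (hφ : ∀ σ ∈ Icc a b, σ ≠ c → HasDerivAt φ (φ' σ) σ) (hbdd : ∀ σ ∈ Icc a b, ‖φ σ‖ ≤ M)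
    (hh : IntegrableOn h (Icc a b))
    (heq : ∀ σ ∈ Icc a b, σ ≠ c →
      cst • (m σ • cross (φ σ) d - ∫ τ in Icc a b, k (τ - σ) • cross (φ τ) d)
        + (1 / 2 : ℝ) • φ σ + α • cross e (φ σ) + w' σ • φ σ + w σ • φ' σ = h σ) :
    ε * (∫ σ in a..b, ‖φ σ‖ ^ 2) + 1 / 2 * (w b * ‖φ b‖ ^ 2 - w a * ‖φ a‖ ^ 2) ≤ ∫ σ in a..b, ⟪h σ, φ σ⟫ := by
  have hab : a ≤ b := (hac.trans hcb).le
  have hwc : Continuous w := continuous_iff_continuousAt.2 fun σ => (hw σ).continuousAt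
  have hφm : AEStronglyMeasurable φ (volume.restrict (Icc a b)) := aestronglyMeasurable_of_hasDerivAt_off hφ
  -- the nonlocal term `N`
  set N : ℝ → EuclideanSpace ℝ (Fin 3) := fun σ => ∫ τ in Icc a b, k (τ - σ) • cross (φ τ) d with hN
  obtain ⟨K, hK0, hK⟩ := kernel_bound_on_ball (a := a) (b := b) hk
  have hNm : AEStronglyMeasurable N (volume.restrict (Icc a b)) := aestronglyMeasurable_nonlocal hk hφm d
  set G : ℝ := K * (M * ‖d‖) * volume.real (Icc a b) with hG
  have hNb : ∀ σ ∈ Icc a b, ‖N σ‖ ≤ G := fun σ hσ => norm_nonlocal_le_of_bounded hK hK0 hbdd d hσ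
  have hG0 : 0 ≤ G := (norm_nonneg _).trans (hNb a ⟨le_rfl, hab⟩)
  -- a bound for `w'` on the ball
  obtain ⟨W, hW⟩ := (isCompact_Icc (a := a) (b := b)).exists_bound_of_continuousOn hw'c.continuousOn
  -- the two forms of the flux derivative
  set p : ℝ → ℝ := fun σ => w' σ * ‖φ σ‖ ^ 2 + 2 * w σ * ⟪φ' σ, φ σ⟫ with hp
  set q : ℝ → ℝ := fun σ => 2 * ⟪h σ, φ σ⟫ + 2 * cst * ⟪N σ, φ σ⟫ - (1 + w' σ) * ‖φ σ‖ ^ 2 with hq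
  have hpq : ∀ σ ∈ Icc a b, σ ≠ c → p σ = q σ := fun σ hσ hσc => flux_deriv_eq_sourced (heq σ hσ hσc)
  -- the three bounded integrands `2cst⟪N, φ⟫`, `(1 + w')‖φ‖²`, `‖φ‖²` are integrable on the ball
  have hHS : IntegrableOn (fun σ => 2 * ⟪h σ, φ σ⟫) (Icc a b) := by
    refine Integrable.mono' ((hh.norm.const_mul (2 * M))) (aestronglyMeasurable_const.mul (hh.aestronglyMeasurable.inner hφm)) ?_
    filter_upwards [ae_restrict_mem measurableSet_Icc] with σ hσ
    rw [Real.norm_eq_abs, abs_mul, abs_two]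
    calc 2 * |⟪h σ, φ σ⟫| ≤ 2 * (‖h σ‖ * M) :=
        mul_le_mul_of_nonneg_left ((abs_real_inner_le_norm _ _).trans
          (mul_le_mul_of_nonneg_left (hbdd σ hσ) (norm_nonneg _))) (by norm_num)
      _ = 2 * M * ‖h σ‖ := by ring
  have hNS : IntegrableOn (fun σ => 2 * cst * ⟪N σ, φ σ⟫) (Icc a b) := by
    refine integrableOn_Icc_of_bounded (aestronglyMeasurable_const.mul (hNm.inner hφm)) (C := 2 * |cst| * (G * M))
      fun σ hσ => ?_
    rw [abs_mul, abs_mul, abs_two]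
    exact mul_le_mul_of_nonneg_left ((abs_real_inner_le_norm _ _).trans
      (mul_le_mul (hNb σ hσ) (hbdd σ hσ) (norm_nonneg _) hG0)) (by positivity)
  have hVS : IntegrableOn (fun σ => (1 + w' σ) * ‖φ σ‖ ^ 2) (Icc a b) := by
    refine integrableOn_Icc_of_bounded (((continuous_const.add hw'c).aestronglyMeasurable).mul ((hφm.norm).pow 2))
      (C := (1 + W) * M ^ 2) fun σ hσ => ?_
    rw [abs_mul, abs_pow, abs_norm]
    have hw1 : |1 + w' σ| ≤ 1 + W := (abs_add_le _ _).trans (by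
      rw [abs_one]; have := hW σ hσ; rw [Real.norm_eq_abs] at this; linarith)
    exact mul_le_mul hw1 (pow_le_pow_left₀ (norm_nonneg _) (hbdd σ hσ) 2) (by positivity)
      (by linarith [abs_nonneg (1 + w' σ)])
  have hsqS : IntegrableOn (fun σ => ‖φ σ‖ ^ 2) (Icc a b) := by
    refine integrableOn_Icc_of_bounded ((hφm.norm).pow 2) (C := M ^ 2) fun σ hσ => ?_
    rw [abs_pow, abs_norm]
    exact pow_le_pow_left₀ (norm_nonneg _) (hbdd σ hσ) 2
  have hqS : IntegrableOn q (Icc a b) := (hHS.add hNS).sub hVS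
  -- hence `p` (which agrees with `q` off the null set `{c}`) is integrable on the ball
  have hae : q =ᵐ[volume.restrict (Icc a b)] p := by
    have hne : ∀ᵐ σ ∂(volume.restrict (Icc a b)), σ ∈ ({c} : Set ℝ)ᶜ :=
      ae_restrict_of_ae (compl_mem_ae_iff.2 (Real.volume_singleton (a := c)))
    filter_upwards [hne, ae_restrict_mem measurableSet_Icc] with σ hσc hσ
    exact (hpq σ hσ hσc).symm
  have hpS : IntegrableOn p (Icc a b) := hqS.congr hae
  -- FTC on the two closed half-balls
  have hPderiv : ∀ σ ∈ Icc a b, σ ≠ c → HasDerivAt (fun x => w x * ‖φ x‖ ^ 2) (p σ) σ :=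
    fun σ hσ hσc => hasDerivAt_flux (hw σ) (hφ σ hσ hσc)
  have hpac : IntervalIntegrable p volume a c := intervalIntegrable_of_integrableOn_Icc hpS le_rfl hac.le hcb.le
  have hpcb : IntervalIntegrable p volume c b := intervalIntegrable_of_integrableOn_Icc hpS hac.le hcb.le le_rfl
  have hleft : ∫ σ in a..c, p σ = 0 - w a * ‖φ a‖ ^ 2 := by
    have h := integral_eq_sub_of_hasDerivAt_of_le hac.le
      (continuousOn_flux hwc hwc0 (Icc_subset_Icc le_rfl hcb.le) hφ hbdd)
      (fun σ hσ => hPderiv σ ⟨hσ.1.le, hσ.2.le.trans hcb.le⟩ hσ.2.ne) hpac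
    rw [h, hwc0, zero_mul]
  have hright : ∫ σ in c..b, p σ = w b * ‖φ b‖ ^ 2 - 0 := by
    have h := integral_eq_sub_of_hasDerivAt_of_le hcb.le
      (continuousOn_flux hwc hwc0 (Icc_subset_Icc hac.le le_rfl) hφ hbdd)
      (fun σ hσ => hPderiv σ ⟨hac.le.trans hσ.1.le, hσ.2.le⟩ hσ.1.ne') hpcb
    rw [h, hwc0, zero_mul]
  have hflux : ∫ σ in a..b, p σ = w b * ‖φ b‖ ^ 2 - w a * ‖φ a‖ ^ 2 := by
    rw [← integral_add_adjacent_intervals hpac hpcb, hleft, hright]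
    ring
  -- the same integral computed through `q`
  have hpq_int : ∫ σ in a..b, p σ = ∫ σ in a..b, q σ := by
    refine intervalIntegral.integral_congr_ae ?_
    have hne : ∀ᵐ σ ∂(volume : Measure ℝ), σ ∈ ({c} : Set ℝ)ᶜ :=
      compl_mem_ae_iff.2 (Real.volume_singleton (a := c))
    filter_upwards [hne] with σ hσc hσ
    rw [uIoc_of_le hab] at hσ
    exact hpq σ ⟨hσ.1.le, hσ.2⟩ hσc
  have hHI : IntervalIntegrable (fun σ => 2 * ⟪h σ, φ σ⟫) volume a b :=
    intervalIntegrable_of_integrableOn_Icc hHS le_rfl hab le_rfl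
  have hNI : IntervalIntegrable (fun σ => 2 * cst * ⟪N σ, φ σ⟫) volume a b :=
    intervalIntegrable_of_integrableOn_Icc hNS le_rfl hab le_rfl
  have hVI : IntervalIntegrable (fun σ => (1 + w' σ) * ‖φ σ‖ ^ 2) volume a b :=
    intervalIntegrable_of_integrableOn_Icc hVS le_rfl hab le_rfl
  have hsqI : IntervalIntegrable (fun σ => ‖φ σ‖ ^ 2) volume a b :=
    intervalIntegrable_of_integrableOn_Icc hsqS le_rfl hab le_rfl
  -- the nonlocal pairing vanishes
  have hN0 : ∫ σ in a..b, 2 * cst * ⟪N σ, φ σ⟫ = 0 := by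
    rw [intervalIntegral.integral_const_mul, integral_of_le hab, ← integral_Icc_eq_integral_Ioc,
      setIntegral_inner_nonlocal_eq_zero_of_bounded hab hk hkev hφm hbdd d, mul_zero]
  have hq_split : ∫ σ in a..b, q σ
      = ((∫ σ in a..b, 2 * ⟪h σ, φ σ⟫) + ∫ σ in a..b, 2 * cst * ⟪N σ, φ σ⟫) - ∫ σ in a..b, (1 + w' σ) * ‖φ σ‖ ^ 2 := by
    simp only [hq]
    rw [intervalIntegral.integral_sub (hHI.add hNI) hVI, intervalIntegral.integral_add hHI hNI]
  have hH2 : ∫ σ in a..b, 2 * ⟪h σ, φ σ⟫ = 2 * ∫ σ in a..b, ⟪h σ, φ σ⟫ := intervalIntegral.integral_const_mul _ _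
  -- coercivity `(1 + w') ≥ 2ε`
  have hmono : ∫ σ in a..b, (2 * ε) * ‖φ σ‖ ^ 2 ≤ ∫ σ in a..b, (1 + w' σ) * ‖φ σ‖ ^ 2 :=
    intervalIntegral.integral_mono_on hab (hsqI.const_mul _) hVI fun σ hσ =>
      mul_le_mul_of_nonneg_right (by linarith [hgrowth σ hσ]) (sq_nonneg _)
  rw [intervalIntegral.integral_const_mul] at hmono
  have hid : w b * ‖φ b‖ ^ 2 - w a * ‖φ a‖ ^ 2
      = 2 * (∫ σ in a..b, ⟪h σ, φ σ⟫) - ∫ σ in a..b, (1 + w' σ) * ‖φ σ‖ ^ 2 := by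
    rw [← hflux, hpq_int, hq_split, hN0, hH2, add_zero]
  linarith

/-- **`L²` SIZE BOUND (stability half of the repaired item (c′), punctured class).**  Under the hypotheses of
`model_adjoint_apriori_punctured`, `ε ∫_a^b ‖φ‖² ≤ ∫_a^b ⟪h, φ⟫`: the density is controlled by its source (for the edge-sourced
equation, by the atoms `e₊, e₋` through `h = cst • (k(·−b) • (e₊ × d) + k(·−a) • (e₋ × d))`). [folklore] -/
theorem model_adjoint_l2_le_punctured {a b c cst α ε M : ℝ} (hac : a < c) (hcb : c < b)
    {k m w w' : ℝ → ℝ} {φ φ' h : ℝ → EuclideanSpace ℝ (Fin 3)} {d e : EuclideanSpace ℝ (Fin 3)}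
    (hk : Continuous k) (hkev : ∀ s, k (-s) = k s)
    (hw : ∀ σ, HasDerivAt w (w' σ) σ) (hw'c : Continuous w') (hwc0 : w c = 0)
    (hwa : w a ≤ 0) (hwb : 0 ≤ w b) (hgrowth : ∀ σ ∈ Icc a b, -1 + 2 * ε ≤ w' σ)
    (hφ : ∀ σ ∈ Icc a b, σ ≠ c → HasDerivAt φ (φ' σ) σ) (hbdd : ∀ σ ∈ Icc a b, ‖φ σ‖ ≤ M)
    (hh : IntegrableOn h (Icc a b))
    (heq : ∀ σ ∈ Icc a b, σ ≠ c →
      cst • (m σ • cross (φ σ) d - ∫ τ in Icc a b, k (τ - σ) • cross (φ τ) d)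
        + (1 / 2 : ℝ) • φ σ + α • cross e (φ σ) + w' σ • φ σ + w σ • φ' σ = h σ) :
    ε * (∫ σ in a..b, ‖φ σ‖ ^ 2) ≤ ∫ σ in a..b, ⟪h σ, φ σ⟫ := by
  have hE := model_adjoint_apriori_punctured hac hcb hk hkev hw hw'c hwc0 hgrowth hφ hbdd hh heq
  have hbd : 0 ≤ 1 / 2 * (w b * ‖φ b‖ ^ 2 - w a * ‖φ a‖ ^ 2) := by
    have h1 : 0 ≤ w b * ‖φ b‖ ^ 2 := mul_nonneg hwb (sq_nonneg _)
    have h2 : w a * ‖φ a‖ ^ 2 ≤ 0 := mul_nonpos_of_nonpos_of_nonneg hwa (sq_nonneg _)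
    linarith
  linarith

/-- **`L²` SIZE of the density in terms of the `L²` size of its source (punctured class).**  Under the hypotheses of
`model_adjoint_l2_le_punctured` with `ε > 0` and a square-integrable source, `∫_a^b ‖φ‖² ≤ ε⁻² ∫_a^b ‖h‖²` (Young's inequality
`⟪h, φ⟫ ≤ ‖h‖²/(2ε) + ε‖φ‖²/2` under the integral).  For the edge-sourced equation `h = cst • (k(·−b) • (e₊ × d) + k(·−a) • (e₋ × d))`
this bounds the interior density by the atoms. [folklore] -/
theorem model_adjoint_l2_size_punctured {a b c cst α ε M : ℝ} (hac : a < c) (hcb : c < b) (hε : 0 < ε)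
    {k m w w' : ℝ → ℝ} {φ φ' h : ℝ → EuclideanSpace ℝ (Fin 3)} {d e : EuclideanSpace ℝ (Fin 3)}
    (hk : Continuous k) (hkev : ∀ s, k (-s) = k s)
    (hw : ∀ σ, HasDerivAt w (w' σ) σ) (hw'c : Continuous w') (hwc0 : w c = 0)
    (hwa : w a ≤ 0) (hwb : 0 ≤ w b) (hgrowth : ∀ σ ∈ Icc a b, -1 + 2 * ε ≤ w' σ)
    (hφ : ∀ σ ∈ Icc a b, σ ≠ c → HasDerivAt φ (φ' σ) σ) (hbdd : ∀ σ ∈ Icc a b, ‖φ σ‖ ≤ M)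
    (hh : IntegrableOn h (Icc a b)) (hh2 : IntegrableOn (fun σ => ‖h σ‖ ^ 2) (Icc a b))
    (heq : ∀ σ ∈ Icc a b, σ ≠ c →
      cst • (m σ • cross (φ σ) d - ∫ τ in Icc a b, k (τ - σ) • cross (φ τ) d)
        + (1 / 2 : ℝ) • φ σ + α • cross e (φ σ) + w' σ • φ σ + w σ • φ' σ = h σ) :
    ∫ σ in a..b, ‖φ σ‖ ^ 2 ≤ (ε ^ 2)⁻¹ * ∫ σ in a..b, ‖h σ‖ ^ 2 := by
  have hab : a ≤ b := (hac.trans hcb).le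
  have hE := model_adjoint_l2_le_punctured hac hcb hk hkev hw hw'c hwc0 hwa hwb hgrowth hφ hbdd hh heq
  have hφm : AEStronglyMeasurable φ (volume.restrict (Icc a b)) := aestronglyMeasurable_of_hasDerivAt_off hφ
  -- integrability of the three integrands on `[a, b]`
  have hIS : IntegrableOn (fun σ => ⟪h σ, φ σ⟫) (Icc a b) := by
    refine Integrable.mono' (hh.norm.mul_const M) (hh.aestronglyMeasurable.inner hφm) ?_
    filter_upwards [ae_restrict_mem measurableSet_Icc] with σ hσ
    rw [Real.norm_eq_abs]
    exact (abs_real_inner_le_norm _ _).trans (mul_le_mul_of_nonneg_left (hbdd σ hσ) (norm_nonneg _))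
  have hsqS : IntegrableOn (fun σ => ‖φ σ‖ ^ 2) (Icc a b) := by
    refine integrableOn_Icc_of_bounded ((hφm.norm).pow 2) (C := M ^ 2) fun σ hσ => ?_
    rw [abs_pow, abs_norm]
    exact pow_le_pow_left₀ (norm_nonneg _) (hbdd σ hσ) 2
  have hII : IntervalIntegrable (fun σ => ⟪h σ, φ σ⟫) volume a b :=
    (hIS.mono_set (by rw [uIcc_of_le hab])).intervalIntegrable
  have hsqI : IntervalIntegrable (fun σ => ‖φ σ‖ ^ 2) volume a b :=
    intervalIntegrable_of_integrableOn_Icc hsqS le_rfl hab le_rfl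
  have hh2I : IntervalIntegrable (fun σ => ‖h σ‖ ^ 2) volume a b :=
    (hh2.mono_set (by rw [uIcc_of_le hab])).intervalIntegrable
  -- Young's inequality under the integral
  have hY : ∫ σ in a..b, ⟪h σ, φ σ⟫ ≤ ∫ σ in a..b, ((2 * ε)⁻¹ * ‖h σ‖ ^ 2 + (ε / 2) * ‖φ σ‖ ^ 2) := by
    refine intervalIntegral.integral_mono_on hab hII ((hh2I.const_mul _).add (hsqI.const_mul _)) fun σ _ => ?_
    have h1 : ⟪h σ, φ σ⟫ ≤ ‖h σ‖ * ‖φ σ‖ := real_inner_le_norm _ _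
    have h2 : 2 * ε * (‖h σ‖ * ‖φ σ‖) ≤ ‖h σ‖ ^ 2 + ε ^ 2 * ‖φ σ‖ ^ 2 := by
      nlinarith [sq_nonneg (‖h σ‖ - ε * ‖φ σ‖)]
    have h3 : ‖h σ‖ * ‖φ σ‖ ≤ (2 * ε)⁻¹ * ‖h σ‖ ^ 2 + (ε / 2) * ‖φ σ‖ ^ 2 := by
      rw [← sub_nonneg]
      have : (2 * ε)⁻¹ * ‖h σ‖ ^ 2 + ε / 2 * ‖φ σ‖ ^ 2 - ‖h σ‖ * ‖φ σ‖
          = (2 * ε)⁻¹ * (‖h σ‖ ^ 2 + ε ^ 2 * ‖φ σ‖ ^ 2 - 2 * ε * (‖h σ‖ * ‖φ σ‖)) := by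
        field_simp
      rw [this]
      exact mul_nonneg (inv_nonneg.2 (by linarith)) (by linarith)
    exact h1.trans h3
  rw [intervalIntegral.integral_add (hh2I.const_mul _) (hsqI.const_mul _), intervalIntegral.integral_const_mul,
    intervalIntegral.integral_const_mul] at hY
  -- `ε X ≤ H/(2ε) + (ε/2) X` ⟹ `X ≤ H/ε²`
  have hX : ε / 2 * ∫ σ in a..b, ‖φ σ‖ ^ 2 ≤ (2 * ε)⁻¹ * ∫ σ in a..b, ‖h σ‖ ^ 2 := by linarith
  have hε2 : 0 < ε ^ 2 := by positivity
  rw [← sub_nonneg] at hX ⊢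
  have : (ε ^ 2)⁻¹ * (∫ σ in a..b, ‖h σ‖ ^ 2) - ∫ σ in a..b, ‖φ σ‖ ^ 2
      = (2 / ε) * ((2 * ε)⁻¹ * (∫ σ in a..b, ‖h σ‖ ^ 2) - ε / 2 * ∫ σ in a..b, ‖φ σ‖ ^ 2) := by
    field_simp
  rw [this]
  exact mul_nonneg (div_nonneg (by norm_num) hε.le) hX

/-- **THE EDGE-SOURCED DENSITY IS BOUNDED BY ITS ATOMS (model, repaired item (c′), punctured class).**  For the adjoint equation
sourced by the edge kernels with atoms `e₊` (at `b`) and `e₋` (at `a`) — the equation of `…Clause13REdgeMeasureModel.edgeMeasure_annihilates`,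
`h σ = cst • (k(σ − b) • (e₊ × d) + k(σ − a) • (e₋ × d))` — every solution differentiable on `S ∖ {c}` and bounded on `S` satisfies
`∫_a^b ‖φ‖² ≤ ε⁻² (b − a) (|cst| K ‖d‖ (‖e₊‖ + ‖e₋‖))²`, where `K` bounds `|k|` on the difference set of the ball.  In particular zero atoms force
a zero density (the homogeneous case, `…Clause13RAdjointPunctured`). [folklore] -/
theorem edge_density_l2_le_atoms {a b c cst α ε M K : ℝ} (hac : a < c) (hcb : c < b) (hε : 0 < ε)
    {k m w w' : ℝ → ℝ} {φ φ' : ℝ → EuclideanSpace ℝ (Fin 3)} {d e ep em : EuclideanSpace ℝ (Fin 3)}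
    (hk : Continuous k) (hkev : ∀ s, k (-s) = k s) (hK : ∀ σ ∈ Icc a b, ∀ τ ∈ Icc a b, |k (τ - σ)| ≤ K) (hK0 : 0 ≤ K)
    (hw : ∀ σ, HasDerivAt w (w' σ) σ) (hw'c : Continuous w') (hwc0 : w c = 0)
    (hwa : w a ≤ 0) (hwb : 0 ≤ w b) (hgrowth : ∀ σ ∈ Icc a b, -1 + 2 * ε ≤ w' σ)
    (hφ : ∀ σ ∈ Icc a b, σ ≠ c → HasDerivAt φ (φ' σ) σ) (hbdd : ∀ σ ∈ Icc a b, ‖φ σ‖ ≤ M)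
    (heq : ∀ σ ∈ Icc a b, σ ≠ c →
      cst • (m σ • cross (φ σ) d - ∫ τ in Icc a b, k (τ - σ) • cross (φ τ) d)
        + (1 / 2 : ℝ) • φ σ + α • cross e (φ σ) + w' σ • φ σ + w σ • φ' σ
        = cst • (k (σ - b) • cross ep d + k (σ - a) • cross em d)) :
    ∫ σ in a..b, ‖φ σ‖ ^ 2 ≤ (ε ^ 2)⁻¹ * ((b - a) * (|cst| * K * ‖d‖ * (‖ep‖ + ‖em‖)) ^ 2) := by
  have hab : a ≤ b := (hac.trans hcb).le
  set h : ℝ → EuclideanSpace ℝ (Fin 3) := fun σ => cst • (k (σ - b) • cross ep d + k (σ - a) • cross em d) with hh_def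
  have hhc : Continuous h :=
    (((hk.comp (continuous_id.sub continuous_const)).smul continuous_const).add
      ((hk.comp (continuous_id.sub continuous_const)).smul continuous_const)).const_smul cst
  have hhS : IntegrableOn h (Icc a b) := hhc.continuousOn.integrableOn_compact isCompact_Icc
  have hh2S : IntegrableOn (fun σ => ‖h σ‖ ^ 2) (Icc a b) :=
    (hhc.norm.pow 2).continuousOn.integrableOn_compact isCompact_Icc
  have hsize := model_adjoint_l2_size_punctured (h := h) hac hcb hε hk hkev hw hw'c hwc0 hwa hwb hgrowth hφ hbdd hhS hh2S
    (fun σ hσ hσc => by rw [heq σ hσ hσc])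
  -- pointwise bound of the edge source on the ball
  have hcx : ∀ x : EuclideanSpace ℝ (Fin 3), ‖cross x d‖ ≤ ‖x‖ * ‖d‖ := fun x => by
    rw [norm_cross]; nlinarith [Real.sin_le_one (InnerProductGeometry.angle x d), mul_nonneg (norm_nonneg x) (norm_nonneg d)]
  have hpt : ∀ σ ∈ Icc a b, ‖h σ‖ ^ 2 ≤ (|cst| * K * ‖d‖ * (‖ep‖ + ‖em‖)) ^ 2 := by
    intro σ hσ
    have hkb : |k (σ - b)| ≤ K := hK b ⟨hab, le_rfl⟩ σ hσ
    have hka : |k (σ - a)| ≤ K := hK a ⟨le_rfl, hab⟩ σ hσ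
    have h1 : ‖h σ‖ ≤ |cst| * K * ‖d‖ * (‖ep‖ + ‖em‖) := by
      rw [hh_def, norm_smul, Real.norm_eq_abs]
      have h2 : ‖k (σ - b) • cross ep d + k (σ - a) • cross em d‖ ≤ K * (‖ep‖ * ‖d‖) + K * (‖em‖ * ‖d‖) := by
        refine (norm_add_le _ _).trans (add_le_add ?_ ?_)
        · rw [norm_smul, Real.norm_eq_abs]; exact mul_le_mul hkb (hcx _) (norm_nonneg _) hK0
        · rw [norm_smul, Real.norm_eq_abs]; exact mul_le_mul hka (hcx _) (norm_nonneg _) hK0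
      calc |cst| * ‖k (σ - b) • cross ep d + k (σ - a) • cross em d‖
          ≤ |cst| * (K * (‖ep‖ * ‖d‖) + K * (‖em‖ * ‖d‖)) := mul_le_mul_of_nonneg_left h2 (abs_nonneg _)
        _ = |cst| * K * ‖d‖ * (‖ep‖ + ‖em‖) := by ring
    exact pow_le_pow_left₀ (norm_nonneg _) h1 2
  have hint : ∫ σ in a..b, ‖h σ‖ ^ 2 ≤ ∫ σ in a..b, (fun _ => (|cst| * K * ‖d‖ * (‖ep‖ + ‖em‖)) ^ 2) σ :=
    intervalIntegral.integral_mono_on hab ((hh2S.mono_set (by rw [uIcc_of_le hab])).intervalIntegrable)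
      intervalIntegrable_const hpt
  rw [intervalIntegral.integral_const, smul_eq_mul] at hint
  exact hsize.trans (mul_le_mul_of_nonneg_left hint (inv_nonneg.2 (sq_nonneg _)))

end Summit.NavierStokesRegularity.NavierStokesRegularity.Theorems.Clause13RAdjointPuncturedApriori

end
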